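import Summits.ValiantsHypothesis.ValiantsHypothesis.Theorems.KPlusLogSqLawTropicalBStaticPadding
import Summits.ValiantsHypothesis.ValiantsHypothesis.Theorems.KPlusLogSqLawTropicalShiftThreeChain

/-!
# Route `KPlusLogSqLaw`, crux `TropicalB` — static `K = 3` capacity is QUADRATIC (corollary of ports + SHIFT-THREE)

HONEST FRAMING.  Support file toward the registered stubs of the crux `TropicalB` (ledger item `stmt-ValiantsHypothesis-19771`,
route `KPlusLogSqLaw`; cell `pub-symmetroid`, seat val-sym-trop-p4, 2026-08-26).  One-line corollaries; nothing asserted about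
`TropicalB` inside its window, `Lifting`, `KPlusLogSqLaw`, `MatrixDescartes` or `VP ≠ VNP`.

* `choose_sub_two_le_of_tropRootLawAtStatic_three` — `TropRootLawAtStatic (m * 3) 3 B → (m+2).choose 2 − 2 ≤ B`: the plain
  3-slope parametric ASSIGNMENT problem on `3m` nodes has instances with `C(m+2,2) − 2` sign-alternating breakpoints
  (SHIFT-THREE of val-sym-lift-p3, `choose_sub_two_le_of_tropRootLawAt_three`, through the port embedding
  `tropRootLawAt_of_static_ports`).  So the static `K = 3` capacity grows quadratically (`≈ M²/18` at size `M`), against the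
  slope-counting ceiling `C(M+2,2) − 1 ≈ M²/2`.
* `choose_sub_two_le_of_tropRootLawAtStatic_three_le` — the same at every size `M ≥ 3m` (static padding).

[folklore] (composition of tree results).
-/

-- `Summit.ValiantsHypothesis.ValiantsHypothesis.…` repeats a component by the D-0017 layout
-- (single-conjunct summit), which the `dupNamespace` linter flags; the name is mandated.
set_option linter.dupNamespace false
set_option autoImplicit false

namespace Summit.ValiantsHypothesis.ValiantsHypothesis.Theorems.LacunarySymmetroidMatrixDescartes.TropicalCensus

/-- **Static `K = 3` capacity is quadratic.**  `TropRootLawAtStatic (m * 3) 3 B → C(m+2, 2) − 2 ≤ B`. [folklore] -/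
theorem choose_sub_two_le_of_tropRootLawAtStatic_three (m B : ℕ) (h : TropRootLawAtStatic (m * 3) 3 B) :
    (m + 2).choose 2 - 2 ≤ B :=
  choose_sub_two_le_of_tropRootLawAt_three m B (tropRootLawAt_of_static_ports m 3 B h)

/-- the same at every static size `M ≥ 3m`. [folklore] -/
theorem choose_sub_two_le_of_tropRootLawAtStatic_three_le (m M B : ℕ) (hM : m * 3 ≤ M)
    (h : TropRootLawAtStatic M 3 B) : (m + 2).choose 2 - 2 ≤ B :=
  choose_sub_two_le_of_tropRootLawAt_three m B (tropRootLawAt_of_static_ports_le hM h)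

end Summit.ValiantsHypothesis.ValiantsHypothesis.Theorems.LacunarySymmetroidMatrixDescartes.TropicalCensus
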